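import Mathlib.InformationTheory.KullbackLeibler.Basic
import HarnessLib

/-!
# Relative entropy against a two-sidedly dominated reference (chain rule in the mean)

Helper file (`--supports`) for the crux
`Summit.AtomisticToContinuum.HydrodynamicLimit.Theses.LambertianContactSwap.SwapGap`
(stmt-AtomisticToContinuum-11850), line `Sketch`, stub S1 `stub_relEntSwap`: the pure measure theory
behind the entropy budget relative to the Lambertian law (`…SwapGapRelEntBudget`).

For σ-finite measures `μ, ν, G` with `μ ≪ G` and a reference `G` that dominates `ν` two-sidedly
through densities, `G · e^{-V} ≤ ν ≤ G · e^{W}` (`V` measurable):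

* `llr_ae_of_dominated` — `μ ≪ ν`, `-V ≤ llr ν G ≤ W` `μ`-a.e., and the chain rule
  `llr μ ν = llr μ G - llr ν G` `μ`-a.e. (`dμ/dν = dμ/dG · dG/dν`, `dG/dν = (dν/dG)⁻¹`,
  `e^{-W} ≤ dG/dν ≤ e^{V}`; Radon–Nikodym algebra `Measure.rnDeriv_mul_rnDeriv`, `Measure.inv_rnDeriv`,
  `Measure.rnDeriv_le_one_of_le`, `Measure.rnDeriv_withDensity`);
* `integral_llr_eq_of_dominated` — for finite `μ` with `V, W, llr μ G` integrable:
  `∫ llr μ ν dμ = ∫ llr μ G dμ - ∫ llr ν G dμ` (all terms integrable);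
* `toReal_klDiv_eq_of_dominated` — for probability measures with `KL(μ ‖ G) < ∞`:
  `KL(μ ‖ ν) < ∞`, `KL(μ ‖ ν) = KL(μ ‖ G) - ∫ llr ν G dμ ≤ KL(μ ‖ G) + ∫ V dμ`.

All [folklore] (Kullback–Leibler chain rule for densities; cf. Kipnis–Landim 1999, App. 1 §8).
prover-line-stmt-AtomisticToContinuum-11850-c1-0 (line lead c1).
-/

noncomputable section

open MeasureTheory Filter Set Topology InformationTheory
open scoped ENNReal

namespace Summit.AtomisticToContinuum.HydrodynamicLimit.Theorems.LambertianContactSwapSwapGapDominatedKL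

/-- **Likelihood ratios against a two-sidedly dominated reference** (pure measure theory, almost-sure
part). If `G · e^{-V} ≤ ν ≤ G · e^{W}` for measurable `V, W`, then for every `μ ≪ G`:
`μ ≪ ν`, `-V ≤ llr ν G ≤ W` `μ`-a.e., and the chain rule `llr μ ν = llr μ G - llr ν G` `μ`-a.e.
(`dμ/dν = dμ/dG · dG/dν`, `dG/dν = (dν/dG)⁻¹` with `e^{-W} ≤ dG/dν ≤ e^{V}`). [folklore] -/
theorem llr_ae_of_dominated {α : Type*} [MeasurableSpace α]
    {μ ν G : Measure α} [SigmaFinite μ] [SigmaFinite ν] [SigmaFinite G] (hμG : μ ≪ G)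
    {V W : α → ℝ} (hV : Measurable V)
    (hlow : G.withDensity (fun x => ENNReal.ofReal (Real.exp (-V x))) ≤ ν)
    (hup : ν ≤ G.withDensity (fun x => ENNReal.ofReal (Real.exp (W x)))) :
    μ ≪ ν ∧ (∀ᵐ x ∂μ, -V x ≤ llr ν G x ∧ llr ν G x ≤ W x) ∧
      (llr μ ν =ᵐ[μ] fun x => llr μ G x - llr ν G x) := by
  set f : α → ℝ≥0∞ := fun x => ENNReal.ofReal (Real.exp (-V x)) with hf
  set g : α → ℝ≥0∞ := fun x => ENNReal.ofReal (Real.exp (W x)) with hg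
  set m : Measure α := G.withDensity f with hm
  set M : Measure α := G.withDensity g with hM
  have hfm : Measurable f := (Real.measurable_exp.comp hV.neg).ennreal_ofReal
  have hf0 : ∀ x, f x ≠ 0 := fun x => (ENNReal.ofReal_pos.2 (Real.exp_pos _)).ne'
  have hGm : G ≪ m := withDensity_absolutelyContinuous' hfm.aemeasurable (ae_of_all _ hf0)
  have hmG : m ≪ G := withDensity_absolutelyContinuous _ _
  have hmν : m ≪ ν := Measure.absolutelyContinuous_of_le hlow
  have hGν : G ≪ ν := hGm.trans hmν
  have hμν : μ ≪ ν := hμG.trans hGν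
  have hμm : μ ≪ m := hμG.trans hGm
  -- (1) chain rule `dμ/dν = dμ/dG · dG/dν`
  have h1 : ∀ᵐ x ∂μ, μ.rnDeriv G x * G.rnDeriv ν x = μ.rnDeriv ν x :=
    hμν.ae_le (Measure.rnDeriv_mul_rnDeriv hμG)
  -- (2) `dG/dν ≤ e^{V}`
  have h2a : ∀ᵐ x ∂μ, G.rnDeriv m x * m.rnDeriv ν x = G.rnDeriv ν x :=
    hμν.ae_le (Measure.rnDeriv_mul_rnDeriv hGm)
  have h2b : ∀ᵐ x ∂μ, m.rnDeriv ν x ≤ 1 := hμν.ae_le (Measure.rnDeriv_le_one_of_le hlow)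
  have h2c : ∀ᵐ x ∂μ, m.rnDeriv G x = f x := hμG.ae_le (Measure.rnDeriv_withDensity G hfm)
  have h2d : ∀ᵐ x ∂μ, (m.rnDeriv G x)⁻¹ = G.rnDeriv m x := hμm.ae_le (Measure.inv_rnDeriv hmG)
  have h2 : ∀ᵐ x ∂μ, G.rnDeriv ν x ≤ ENNReal.ofReal (Real.exp (V x)) := by
    filter_upwards [h2a, h2b, h2c, h2d] with x ha hb hc hd
    rw [← ha, ← hd, hc, hf]
    dsimp only
    rw [← ENNReal.ofReal_inv_of_pos (Real.exp_pos _), Real.exp_neg, inv_inv]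
    calc ENNReal.ofReal (Real.exp (V x)) * m.rnDeriv ν x
        ≤ ENNReal.ofReal (Real.exp (V x)) * 1 := by gcongr
      _ = ENNReal.ofReal (Real.exp (V x)) := mul_one _
  -- (3) `e^{-W} ≤ dG/dν`
  have h3a : ν.rnDeriv G ≤ᵐ[G] g := by
    refine ae_le_of_forall_setLIntegral_le_of_sigmaFinite (Measure.measurable_rnDeriv _ _)
      fun s hs _ => ?_
    calc ∫⁻ x in s, ν.rnDeriv G x ∂G ≤ ν s := Measure.setLIntegral_rnDeriv_le s
      _ ≤ M s := hup s
      _ = ∫⁻ x in s, g x ∂G := by rw [hM, withDensity_apply _ hs]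
  have h3b : ∀ᵐ x ∂μ, (G.rnDeriv ν x)⁻¹ = ν.rnDeriv G x := hμG.ae_le (Measure.inv_rnDeriv hGν)
  have h3 : ∀ᵐ x ∂μ, ENNReal.ofReal (Real.exp (-W x)) ≤ G.rnDeriv ν x := by
    filter_upwards [hμG.ae_le h3a, h3b] with x ha hb
    rw [← inv_inv (G.rnDeriv ν x), hb, Real.exp_neg, ENNReal.ofReal_inv_of_pos (Real.exp_pos _)]
    exact ENNReal.inv_le_inv.2 ha
  -- (4) positivity and finiteness of `dμ/dG`
  have h4a : ∀ᵐ x ∂μ, 0 < μ.rnDeriv G x := Measure.rnDeriv_pos hμG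
  have h4b : ∀ᵐ x ∂μ, μ.rnDeriv G x < ∞ := hμG.ae_le (Measure.rnDeriv_lt_top μ G)
  -- the correction term `R = log (dG/dν) = - llr ν G` and its bounds
  set R : α → ℝ := fun x => Real.log (G.rnDeriv ν x).toReal with hR
  have hRb : ∀ᵐ x ∂μ, -W x ≤ R x ∧ R x ≤ V x := by
    filter_upwards [h2, h3] with x h2x h3x
    have htop : G.rnDeriv ν x ≠ ∞ := ne_top_of_le_ne_top ENNReal.ofReal_ne_top h2x
    have hlo : Real.exp (-W x) ≤ (G.rnDeriv ν x).toReal :=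
      (ENNReal.ofReal_le_iff_le_toReal htop).1 h3x
    have hhi : (G.rnDeriv ν x).toReal ≤ Real.exp (V x) :=
      ENNReal.toReal_le_of_le_ofReal (Real.exp_pos _).le h2x
    have hpos : 0 < (G.rnDeriv ν x).toReal := (Real.exp_pos _).trans_le hlo
    constructor
    · have := Real.log_le_log (Real.exp_pos _) hlo
      rwa [Real.log_exp] at this
    · have := Real.log_le_log hpos hhi
      rwa [Real.log_exp] at this
  have hRllr : ∀ᵐ x ∂μ, llr ν G x = -R x := by
    filter_upwards [h3b] with x hx
    simp only [llr, hR]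
    rw [← hx, ENNReal.toReal_inv, Real.log_inv]
  -- `llr μ ν = llr μ G + R` almost surely
  have hllr : llr μ ν =ᵐ[μ] fun x => llr μ G x + R x := by
    filter_upwards [h1, h2, h3, h4a, h4b] with x h1x h2x h3x h4x h4x'
    have hGpos : 0 < (G.rnDeriv ν x).toReal :=
      ENNReal.toReal_pos ((ENNReal.ofReal_pos.2 (Real.exp_pos _)).trans_le h3x).ne'
        (ne_top_of_le_ne_top ENNReal.ofReal_ne_top h2x)
    have hμpos : 0 < (μ.rnDeriv G x).toReal := ENNReal.toReal_pos h4x.ne' h4x'.ne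
    simp only [llr, hR]
    rw [← h1x, ENNReal.toReal_mul, Real.log_mul hμpos.ne' hGpos.ne']
  refine ⟨hμν, ?_, ?_⟩
  · filter_upwards [hRb, hRllr] with x hx hx'
    rw [hx']
    exact ⟨by linarith [hx.2], by linarith [hx.1]⟩
  · filter_upwards [hllr, hRllr] with x hx hx'
    rw [hx, hx', sub_neg_eq_add]

/-- **Integrability and the chain rule in the mean.** If moreover `μ` is finite, `V, W` are
`μ`-integrable and `llr μ G` is `μ`-integrable, then `llr ν G` and `llr μ ν` are `μ`-integrable and
`∫ llr μ ν dμ = ∫ llr μ G dμ - ∫ llr ν G dμ`. [folklore] -/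
theorem integral_llr_eq_of_dominated {α : Type*} [MeasurableSpace α]
    {μ ν G : Measure α} [IsFiniteMeasure μ] [SigmaFinite ν] [SigmaFinite G]
    (hμG : μ ≪ G) (hint : Integrable (llr μ G) μ)
    {V W : α → ℝ} (hV : Measurable V) (hVi : Integrable V μ) (hWi : Integrable W μ)
    (hlow : G.withDensity (fun x => ENNReal.ofReal (Real.exp (-V x))) ≤ ν)
    (hup : ν ≤ G.withDensity (fun x => ENNReal.ofReal (Real.exp (W x)))) :
    μ ≪ ν ∧ Integrable (llr μ ν) μ ∧ Integrable (llr ν G) μ ∧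
      (∀ᵐ x ∂μ, -V x ≤ llr ν G x ∧ llr ν G x ≤ W x) ∧
      ∫ x, llr μ ν x ∂μ = ∫ x, llr μ G x ∂μ - ∫ x, llr ν G x ∂μ := by
  obtain ⟨hμν, hbd, hllr⟩ := llr_ae_of_dominated hμG hV hlow hup
  have hiν : Integrable (llr ν G) μ := by
    refine Integrable.mono' (hVi.abs.add hWi.abs) (measurable_llr _ _).aestronglyMeasurable ?_
    filter_upwards [hbd] with x hx
    obtain ⟨hlo, hhi⟩ := hx
    rw [Real.norm_eq_abs]
    simp only [Pi.add_apply]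
    have h1' := le_abs_self (V x)
    have h2' := le_abs_self (W x)
    exact abs_le.2 ⟨by linarith [abs_nonneg (W x)], by linarith [abs_nonneg (V x)]⟩
  refine ⟨hμν, (hint.sub hiν).congr hllr.symm, hiν, hbd, ?_⟩
  rw [integral_congr_ae hllr, integral_sub hint hiν]

/-- **KL version** (probability measures): under the hypotheses of `integral_llr_eq_of_dominated`
and `KL(μ ‖ G) < ∞`: `KL(μ ‖ ν) < ∞`, the exact decomposition
`KL(μ ‖ ν) = KL(μ ‖ G) - ∫ llr ν G dμ`, and the budget `KL(μ ‖ ν) ≤ KL(μ ‖ G) + ∫ V dμ`.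
[folklore] -/
theorem toReal_klDiv_eq_of_dominated {α : Type*} [MeasurableSpace α]
    {μ ν G : Measure α} [IsProbabilityMeasure μ] [IsProbabilityMeasure ν]
    [IsProbabilityMeasure G] (hμG : μ ≪ G) (hfin : klDiv μ G ≠ ∞)
    {V W : α → ℝ} (hV : Measurable V) (hVi : Integrable V μ) (hWi : Integrable W μ)
    (hlow : G.withDensity (fun x => ENNReal.ofReal (Real.exp (-V x))) ≤ ν)
    (hup : ν ≤ G.withDensity (fun x => ENNReal.ofReal (Real.exp (W x)))) :
    klDiv μ ν ≠ ∞ ∧ Integrable (llr ν G) μ ∧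
      (klDiv μ ν).toReal = (klDiv μ G).toReal - ∫ x, llr ν G x ∂μ ∧
      (klDiv μ ν).toReal ≤ (klDiv μ G).toReal + ∫ x, V x ∂μ := by
  have hint : Integrable (llr μ G) μ := (klDiv_ne_top_iff.1 hfin).2
  obtain ⟨hac, hi, hiν, hbd, heq⟩ := integral_llr_eq_of_dominated hμG hint hV hVi hWi hlow hup
  refine ⟨klDiv_ne_top hac hi, hiν, ?_, ?_⟩
  · rw [toReal_klDiv_of_measure_eq hac (by simp), toReal_klDiv_of_measure_eq hμG (by simp)]
    exact heq
  · rw [toReal_klDiv_of_measure_eq hac (by simp), toReal_klDiv_of_measure_eq hμG (by simp), heq,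
      sub_eq_add_neg, ← integral_neg]
    exact add_le_add le_rfl (integral_mono_ae hiν.neg hVi (hbd.mono fun x hx => by
      linarith [hx.1]))

end Summit.AtomisticToContinuum.HydrodynamicLimit.Theorems.LambertianContactSwapSwapGapDominatedKL

end
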